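import Literature.NumberTheory.ComplexMultiplication.CMInfinityTypeExponentOfHodgeType
import Literature.NumberTheory.Automorphic.ConjugateSelfDualInfinityType
import HarnessLib

/-!
# The orientation conjunct `p w₁ = (1 − e w₁)/2`, INTRINSIC form (no distinguished representative of the base place)

Layer `Literature/NumberTheory/ComplexMultiplication`.  THEOREMS ONLY (no definition, no named fact, no instance, no
`sorry`).  Sequel of ★ `CMInfinityTypeExponentOfHodgeType` (cell hodgecm-mathlib, d6 line, card v3.5: A-plan2 (g11)
2026-08-29T21:13:32Z word; REF1 (g10) m06 H-R3 reading of the probe's `J2Shape`).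

THE POINT.  Both sides of the d6 orientation conjunct «first exponent of `χ_τ` at `w₁ = mk σ₀` equals `(1 − e w₁)/2`» are read
through Mathlib's distinguished representative `(mk σ₀).embedding ∈ {σ₀, σ̄₀}`, which nobody can decide; under the swap of
representative both sides flip together.  Hence the conjunct follows from INTRINSIC data only:
* the reflex inclusion `K*(Φ) ⊆ σ₀(F)` (a HYPOTHESIS `hk` here — supplied in the application by ★
  `IsCMTypeRealisationOver.traceField_le_fieldRange`, [Shimura1998] §8.5 Prop. 30 — instead of the tower instances of the
  prequel), under which `σ₀ ∈ Ψ_τ(σ₀) ↔ τ ∈ Φ` and `σ̄₀ ∈ Ψ_τ(σ₀) ↔ τ ∉ Φ` ([Shimura1998] §8.3 Prop. 28, §13.1 (7));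
* a zero-free ∞-type `e` of the base CM field `F` of weight one at `mk σ₀` (`|e (mk σ₀)| = 1`) with its CM type
  `Φ_e = cmTypeOf F e` ([Liu2021] Def. 4.3: `φ ∈ Φ_e ↔ exponentAt e φ < 0`; ★ `exponentAt_embedding`,
  ★ `exponentAt_conjugate_embedding`);
* the ONE orientation sentence **`τ ∈ Φ ↔ σ₀ ∈ Φ_e`** — which the d6 line obtains from S1 clause (2) («the block is of Hodge type
  `(1,0)` iff `ι₁ ∈ Φ_μ`») through ★ `IsCMTypeRealisation.mem_of_isOfHodgeType_oneZero` / `not_mem_of_isOfHodgeType_zeroOne`;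
  packaged here as `IsCMTypeRealisation.mem_iff_of_isOfHodgeType_ite`.

CONTENT: §1 `self_mem_reflexTypeOn_iff_of_traceField_le`, `conjugate_mem_reflexTypeOn_self_iff_of_traceField_le` (hk-forms of
the prequel's §1); §2 **`cmInfinityType_fst_mk_eq_half_one_sub_of_iff`** (generic `e`) and **`…_of_isConjugateSymplectic`**
(`e := hμ.infinityType`, weight one from `HasWeight F μ 1`: the LAST LINE of the probe's `J2Shape`, `σ₀ := ι₁`); §3 the
Hodge-side producer of the orientation sentence and the end-to-end corollary `IsCMTypeRealisation.cmInfinityType_fst_mk_eq_half_one_sub`.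
HC_CM is proved only modulo the 7 printed citations until rung 0 closes; nothing here moves a book.

## References
* [Shimura1998] G. Shimura, *Abelian Varieties with Complex Multiplication and Modular Functions* (1998): §5.2 (pp. 39–40),
  §8.3 Prop. 28, §8.5 Prop. 30, §13.1 (7), Prop. 19.10 (19.10a) (p. 135).
* [Liu2021] Y. Liu, Camb. J. Math. **9** (2021): Remark 4.2 and Def. 4.3 (`Φ_μ`, the weight `𝔴_μ`), App. D, proof of Thm. D.6 (1)
  (FJcycle.tex l. 5625–5630).
* [MilneCM2006] J. S. Milne, *Complex Multiplication* (notes), Ch. I §1 Prop. 1.23.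
-/

set_option autoImplicit false

noncomputable section

open NumberField
open Literature.AlgebraicGeometry.Motives (CMType AbelianVariety)
open Literature.AlgebraicGeometry.HodgeTheory
open Literature.NumberTheory.Automorphic.PicardCM (eigenline)
open Literature.NumberTheory.Automorphic.IdeleClassGroup

namespace Literature.NumberTheory.ComplexMultiplication

variable {M : Type} [Field M] [NumberField M] (Φ : CMType M) (τ : M →+* ℂ)
variable {F : Type} [Field F] (σ₀ : F →+* ℂ)

/-! ## §1 The reflex type at the base embedding, under the reflex inclusion `K* ⊆ σ₀(F)` -/

omit [NumberField M] in
/-- Conjugating twice gives the embedding back. [cite: Shimura1998, §13.1 (7)] -/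
private theorem conjugate_conjugate_eq₃ {k' : Type} [Field k'] (σ : k' →+* ℂ) :
    ComplexEmbedding.conjugate (ComplexEmbedding.conjugate σ) = σ :=
  RingHom.ext fun x => by simp

/-- **`σ₀ ∈ Ψ_τ(σ₀) ↔ τ ∈ Φ`** when `σ₀(F) ⊇ K*`: an automorphism of `ℂ` fixing `σ₀(F)` pointwise fixes `K*`, hence stabilises
`Φ` (Prop. 28). [cite: Shimura1998, §8.3 Prop. 28 and §13.1 (7)] [cite: MilneCM2006, Ch. I §1 Prop. 1.23] -/
theorem self_mem_reflexTypeOn_iff_of_traceField_le (hk : (traceField Φ).toSubfield ≤ σ₀.fieldRange) :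
    σ₀ ∈ reflexTypeOn Φ.1 τ σ₀ ↔ τ ∈ Φ.1 := by
  refine ⟨fun h => ?_, fun hτ => self_mem_reflexTypeOn _ hτ⟩
  obtain ⟨g, hg, hgσ⟩ := (mem_reflexTypeOn_iff _ _ _ _).1 h
  have hfix : ∀ z : ℂ, z ∈ traceField Φ → g z = z := fun z hz => by
    obtain ⟨x, rfl⟩ := hk hz
    simpa using RingHom.congr_fun hgσ x
  have hstab := forall_smul_mem_iff_of_forall_apply_traceField_eq g Φ hfix (g⁻¹ • τ)
  rw [smul_inv_smul] at hstab
  exact hstab.2 hg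

/-- **`σ̄₀ ∈ Ψ_τ(σ₀) ↔ τ ∉ Φ`** when `σ₀(F) ⊇ K*`: `Ψ_{τ̄} = conj ∘ Ψ_τ` (★ `mem_reflexTypeOn_conjugate_iff`) and `Φ` contains
exactly one of `τ, τ̄`. [cite: Shimura1998, §8.3 Prop. 28 and §13.1 (7)] [cite: MilneCM2006, Ch. I §1 Prop. 1.23] -/
theorem conjugate_mem_reflexTypeOn_self_iff_of_traceField_le (hk : (traceField Φ).toSubfield ≤ σ₀.fieldRange) :
    ComplexEmbedding.conjugate σ₀ ∈ reflexTypeOn Φ.1 τ σ₀ ↔ τ ∉ Φ.1 := by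
  have hcc : (starRingAut : ℂ ≃+* ℂ) * starRingAut = 1 := by
    ext x
    exact Complex.conj_conj x
  -- `Ψ_τ = conj ∘ Ψ_{τ̄}` (`reflexTypeOn_smul_left` at complex conjugation)
  have key : (starRingAut : ℂ ≃+* ℂ) • σ₀ ∈ reflexTypeOn Φ.1 τ σ₀ ↔
      σ₀ ∈ reflexTypeOn Φ.1 ((starRingAut : ℂ ≃+* ℂ) • τ) σ₀ := by
    conv_lhs => rw [show τ = (starRingAut : ℂ ≃+* ℂ) • ((starRingAut : ℂ ≃+* ℂ) • τ) by
      rw [smul_smul, hcc, one_smul]]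
    rw [reflexTypeOn_smul_left, Set.smul_mem_smul_set_iff]
  rw [← starRingAut_smul_eq_conjugate, key, self_mem_reflexTypeOn_iff_of_traceField_le Φ _ σ₀ hk,
    starRingAut_smul_eq_conjugate, Φ.2 (ComplexEmbedding.conjugate τ), conjugate_conjugate_eq₃]

/-! ## §2 The orientation conjunct, intrinsic form -/

/-- **`p_{w₁}(χ_τ) = (1 − e(w₁))/2`, INTRINSIC FORM.**  For a CM type `(M, Φ)`, an embedding `τ : M → ℂ`, a base CM field `F`
with `σ₀ : F → ℂ` containing the reflex field (`hk`), and a zero-free ∞-type `e` on `F` of weight one at `w₁ = mk σ₀`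
(`|e w₁| = 1`) with CM type `Φ_e = cmTypeOf F e`: IF `τ ∈ Φ ↔ σ₀ ∈ Φ_e` (the one orientation sentence), THEN the first exponent of
`cmInfinityType Φ τ σ₀` at `w₁` is `(1 − e w₁)/2`.  Proof: case split on `(mk σ₀).embedding ∈ {σ₀, σ̄₀}` (Mathlib `embedding_mk_eq`);
in either case both sides are read in the same coordinate (`σ₀ ∈ Ψ_τ ↔ τ ∈ Φ` / `σ̄₀ ∈ Ψ_τ ↔ τ ∉ Φ`, and
`e w₁ = exponentAt e (mk σ₀).embedding`, `exponentAt e σ̄₀ = − exponentAt e σ₀`).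
[cite: Shimura1998, Prop. 19.10 (19.10a) and §13.1 (7)] [cite: Liu2021, Remark 4.2 and Def. 4.3; App. D, proof of Thm. D.6 (1) (FJcycle.tex l. 5625–5630)] -/
theorem cmInfinityType_fst_mk_eq_half_one_sub_of_iff [NumberField F] [IsCMField F]
    (hk : (traceField Φ).toSubfield ≤ σ₀.fieldRange) {e : InfinitePlace F → ℤ} (he : ∀ w, e w ≠ 0)
    (h1 : (e (InfinitePlace.mk σ₀)).natAbs = 1) (hiff : τ ∈ Φ.1 ↔ σ₀ ∈ (cmTypeOf F e he).1) :
    (cmInfinityType Φ.1 τ σ₀).1 (InfinitePlace.mk σ₀) = (1 - e (InfinitePlace.mk σ₀)) / 2 := by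
  have hσ₀ : ¬ ComplexEmbedding.IsReal σ₀ := by
    rw [← InfinitePlace.isComplex_mk_iff]
    exact IsTotallyComplex.isComplex _
  have habs : e (InfinitePlace.mk σ₀) = 1 ∨ e (InfinitePlace.mk σ₀) = -1 := by omega
  rw [cmInfinityType_fst]
  rcases InfinitePlace.embedding_mk_eq σ₀ with hemb | hemb
  · -- coordinate `σ₀`: `p = [σ₀ ∈ Ψ_τ] = [τ ∈ Φ] = [σ₀ ∈ Φ_e] = [exponentAt e σ₀ < 0] = [e w₁ < 0]`
    have hexp : e (InfinitePlace.mk σ₀) = exponentAt e σ₀ := by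
      conv_lhs => rw [← exponentAt_embedding e (InfinitePlace.mk σ₀), hemb]
    rw [hemb]
    by_cases hτ : τ ∈ Φ.1
    · rw [Set.indicator_of_mem ((self_mem_reflexTypeOn_iff_of_traceField_le Φ τ σ₀ hk).2 hτ)]
      have hlt : exponentAt e σ₀ < 0 := mem_cmTypeOf_iff.1 (hiff.1 hτ)
      omega
    · rw [Set.indicator_of_notMem (fun h => hτ ((self_mem_reflexTypeOn_iff_of_traceField_le Φ τ σ₀ hk).1 h))]
      have hlt : ¬ exponentAt e σ₀ < 0 := fun h => hτ (hiff.2 (mem_cmTypeOf_iff.2 h))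
      omega
  · -- coordinate `σ̄₀`: `p = [σ̄₀ ∈ Ψ_τ] = [τ ∉ Φ] = [σ₀ ∉ Φ_e] = [0 < exponentAt e σ₀] = [e w₁ < 0]`
    have hexp : e (InfinitePlace.mk σ₀) = -exponentAt e σ₀ := by
      conv_lhs => rw [← exponentAt_embedding e (InfinitePlace.mk σ₀), hemb]
      exact exponentAt_conjugate e hσ₀
    rw [hemb]
    by_cases hτ : τ ∈ Φ.1
    · rw [Set.indicator_of_notMem
        (fun h => ((conjugate_mem_reflexTypeOn_self_iff_of_traceField_le Φ τ σ₀ hk).1 h) hτ)]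
      have hlt : exponentAt e σ₀ < 0 := mem_cmTypeOf_iff.1 (hiff.1 hτ)
      omega
    · rw [Set.indicator_of_mem ((conjugate_mem_reflexTypeOn_self_iff_of_traceField_le Φ τ σ₀ hk).2 hτ)]
      have hlt : ¬ exponentAt e σ₀ < 0 := fun h => hτ (hiff.2 (mem_cmTypeOf_iff.2 h))
      omega

/-- **The `J2Shape` last line**: for a conjugate-symplectic `μ` on the base CM field `F` of WEIGHT ONE (`HasWeight F μ 1`), with
canonical ∞-type `e := hμ.infinityType` and CM type `Φ_μ := hμ.cmType`, and realisation data with reflex field inside `σ₀(F)`: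
IF `τ ∈ Φ ↔ σ₀ ∈ Φ_μ` THEN `(cmInfinityType Φ τ σ₀).1 (mk σ₀) = (1 − e (mk σ₀))/2` (the first exponent of `μ^{alg}`,
★ `hasInfinityType_muAlg`). [cite: Liu2021, Remark 4.2 and Def. 4.3; App. D, proof of Thm. D.6 (1) (FJcycle.tex l. 5625–5630)]
[cite: Shimura1998, Prop. 19.10 (19.10a)] -/
theorem cmInfinityType_fst_mk_eq_half_one_sub_of_isConjugateSymplectic [NumberField F] [IsCMField F]
    (hk : (traceField Φ).toSubfield ≤ σ₀.fieldRange)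
    {μ : Literature.NumberTheory.Automorphic.IdeleClassGroup F →ₜ* Circle} (hμ : IsConjugateSymplectic F μ)
    (hw : HasWeight F μ 1) (hiff : τ ∈ Φ.1 ↔ σ₀ ∈ hμ.cmType.1) :
    (cmInfinityType Φ.1 τ σ₀).1 (InfinitePlace.mk σ₀) = (1 - hμ.infinityType (InfinitePlace.mk σ₀)) / 2 := by
  refine cmInfinityType_fst_mk_eq_half_one_sub_of_iff Φ τ σ₀ hk hμ.infinityType_ne_zero ?_ hiff
  have h := congrFun (hμ.weightOf_eq hw) (InfinitePlace.mk σ₀)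
  simpa [IsConjugateSymplectic.weightOf] using h

/-! ## §3 The orientation sentence from the Hodge type of the `τ`-eigenline -/

variable {Φ τ}
variable {A : AbelianVariety ℂ} {ι : 𝓞 M →+* CategoryTheory.End A} {θ : M →+* Module.End ℂ (complexBetti A.X 1)}

/-- **`τ ∈ Φ ↔ P` from a non-zero `τ`-eigenvector of Hodge type `(1,0)` if `P`, `(0,1)` if `¬P`** — the shape of S1 clause (2)
of the d6 line (`P := ι₁ ∈ Φ_μ`), read through ★ `mem_of_isOfHodgeType_oneZero` / `not_mem_of_isOfHodgeType_zeroOne`.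
[cite: Shimura1998, §5.2 (pp. 39–40)] -/
theorem _root_.Literature.AlgebraicGeometry.ComplexMultiplication.IsCMTypeRealisation.mem_iff_of_isOfHodgeType_ite
    (h : Literature.AlgebraicGeometry.ComplexMultiplication.IsCMTypeRealisation Φ A ι θ)
    {v : complexBetti A.X 1} (hv : v ∈ eigenline θ τ) (hv0 : v ≠ 0) {P : Prop} [Decidable P]
    (hab : IsOfHodgeType (Module.finrank ℚ M / 2) A.X 1 (if P then 1 else 0) (if P then 0 else 1) v) :
    τ ∈ Φ.1 ↔ P := by
  by_cases hP : P
  · rw [if_pos hP, if_pos hP] at hab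
    exact ⟨fun _ => hP, fun _ => h.mem_of_isOfHodgeType_oneZero hv hv0 hab⟩
  · rw [if_neg hP, if_neg hP] at hab
    exact ⟨fun hτ => absurd hτ (h.not_mem_of_isOfHodgeType_zeroOne hv hv0 hab), fun hp => absurd hp hP⟩

/-- **END TO END (complex realisation form)**: realisation `(A, ι)` of type `(M, Φ)` over `ℂ` read on `H¹`, a non-zero
`τ`-eigenvector of Hodge type `(1,0)`/`(0,1)` according as `σ₀ ∈ Φ_μ` or not, the reflex inclusion `K* ⊆ σ₀(F)`, `μ`
conjugate-symplectic of weight one ⟹ the `J2Shape` last line. [cite: Shimura1998, §5.2 (pp. 39–40) and Prop. 19.10 (19.10a)]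
[cite: Liu2021, App. D, proof of Thm. D.6 (1) (FJcycle.tex l. 5625–5630)] -/
theorem _root_.Literature.AlgebraicGeometry.ComplexMultiplication.IsCMTypeRealisation.cmInfinityType_fst_mk_eq_half_one_sub
    [NumberField F] [IsCMField F]
    (h : Literature.AlgebraicGeometry.ComplexMultiplication.IsCMTypeRealisation Φ A ι θ)
    (hk : (traceField Φ).toSubfield ≤ σ₀.fieldRange)
    {μ : Literature.NumberTheory.Automorphic.IdeleClassGroup F →ₜ* Circle} (hμ : IsConjugateSymplectic F μ)
    (hw : HasWeight F μ 1) [Decidable (σ₀ ∈ hμ.cmType.1)]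
    {v : complexBetti A.X 1} (hv : v ∈ eigenline θ τ) (hv0 : v ≠ 0)
    (hab : IsOfHodgeType (Module.finrank ℚ M / 2) A.X 1 (if σ₀ ∈ hμ.cmType.1 then 1 else 0)
      (if σ₀ ∈ hμ.cmType.1 then 0 else 1) v) :
    (cmInfinityType Φ.1 τ σ₀).1 (InfinitePlace.mk σ₀) = (1 - hμ.infinityType (InfinitePlace.mk σ₀)) / 2 :=
  cmInfinityType_fst_mk_eq_half_one_sub_of_isConjugateSymplectic Φ τ σ₀ hk hμ hw
    (h.mem_iff_of_isOfHodgeType_ite hv hv0 hab)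

end Literature.NumberTheory.ComplexMultiplication
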